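/-
Copyright (c) 2026 the pub-hodgecm-mathlib formalisation cell (harness21).  Prover seat hodgecm-mathlib-LH1-p01 (g5): line LH1 (chair LH1-plan (g4)),
deal (C5) «CERT ED. 5» — the equivalence certificate of LEAF ED. 5 «Ξ∞ ∕ QPSI ± 1»; 2026-09-02.
-/
import Summits.HodgeConjecture.HodgeConjecture.Theorems.F0P3cS2SharpOrgansOfS2SharpKompakt   -- ★ (C4) «Cert» ED. 4 (this seat): letters `S2FinLetter` ∕ `S2CasimirIotaLetter`, head `s2sharp_of_organsKompakt`, read-backs
import Summits.HodgeConjecture.HodgeConjecture.Theorems.F0P3cS2SharpQpsi                   -- ★ (Q1) p850418 (LH1-p03 (g4)): `qpsi_of_S2sharp`, `sq_sum_eq_two_of_qpsi`, `casimirTau_of_qpsi`, `pinCompact_of_qpsi`, `isCohTrivialAt_of_qpsi`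
import HarnessLib

/-!
# Crux `H413`, half A line LH1 — THE EQUIVALENCE CERTIFICATE for LEAF ED. 5 «Ξ∞» of the pay-down of the closer stub `stub_S2sharp`:
# S2♯ (#80) ⟺ FIN ∧ QPSI, with the letter «Ξ∞ ∕ QPSI ± 1» on the CENTRAL-ι frame (no `K_c` clause, no token)

Cell `hodgecm-mathlib` (D-0151), FLOOR 0, crux item H413 = `stmt-HodgeConjecture-24833` (`--supports`, helper), route of record `HCCMUnconditional`; half A line LH1,
prover LH1-p01 (g5) on LH1-plan (g4)'s words 2026-09-02T08:07:10Z («if the glue lands before you file, ADD `s2sharp_iff_organsXiInf` — else it is (C5)») and 08:12:58Z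
(LEAF ED. 5 «Ξ∞»: chair's LETTER CHOICE).  One closed-`Prop` letter + theorems (no instance, no notation, no named fact, no `sorry`); never imports a
`Cruxes/…/Lines` module; the letter carries PROSE locators (gate relocation rule for `def … : Prop` under `Theorems/`).

THE OBJECTS.  LEAF ED. 4 «Kompakt» (tree sha16 ac97d3c1aa44bf02) has organs FIN · CASIMIR-ι · CASIMIR-τ (★ (C4) certifies `S2♯ ↔ FIN ∧ CASIMIR-ι ∧ CASIMIR-τ`).
LH1-p03 (g4)'s PLACEMENT (memo `QPSI-PLACEMENT.LH1p03g4.md`; [Marshall2014 §3.3, §3.4, §4.1 `Ξ_∞`]) prints the archimedean condition at EVERY archimedean place as ONE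
token-free sentence — «the `det`-exponent of `ξ` is `±1` at every complex embedding» — and ★ (Q1) `F0P3cS2SharpQpsi` proved its read-backs as TELESCOPES on the PIN-τ
frame (with the `K_c` clause).  LEAF ED. 5 «Ξ∞» (LH1-plan (g4), pen) replaces CASIMIR-ι ∧ CASIMIR-τ by the single organ `stub_S2qpsi : S2QpsiLetter`, sorries 3 → 2.
THIS FILE:
* §1 LETTER `S2QpsiLetter` — the chair's text 08:12:58Z TOKEN FOR TOKEN: the CENTRAL-ι frame (= ★ (B0) `F0P3cXiCentralIotaOfOrgans.S2CentralIotaLetter`'s binders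
  through `MemXiFamily P … ξ →`; NO `K_c` clause, NO token), conclusion `∀ τ : L →+* ℂ, ξ.qψ τ = 1 ∨ ξ.qψ τ = -1`.  It is STRONGER than (Q1)'s telescope by exactly
  the `K_c` clause, which is REDUNDANT on a cotangent `P` (★ p819716 `cmCompactFactor_rightRegular_eq_self_of_isHolOrAntihol`) — `qpsiTelescope_of_qpsi` ∕
  `qpsi_of_S2sharp'` below make both directions explicit — so LEAF ED. 5 §1 may restate it byte for byte and the QA tie is `Iff.rfl`.
* §2 (⟹) `qpsi_of_S2sharp' : S2♯ → S2QpsiLetter` (★ (Q1) `qpsi_of_S2sharp` + ★ p819716 for the dropped clause).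
* §3 «Ξ∞» ⟹ the ED. 4 organs: `casimirIota_of_qpsi : S2QpsiLetter → S2CasimirIotaLetter` (★ (Q1) `sq_sum_eq_two_of_qpsi` at `τ = ι`; the token binders unused),
  `casimirTau_of_qpsi' : S2QpsiLetter → S2CasimirTauLetter`, `pinCompact_of_qpsi' : S2QpsiLetter → S2PinCompactLetter` (★ (Q1) by name).
* §4 (⟸) `s2sharp_of_fin_qpsi : S2FinLetter → S2QpsiLetter → S2♯` := ★ (C4) head `s2sharp_of_organsKompakt` ∘ §3 — ED. 5's head FACTORS THROUGH ED. 4's organ set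
  (chair 08:07:10Z «ED. 4's organ set stays a valid factorisation»).
* §5 THE CERTIFICATE `s2sharp_iff_organsXiInf : S2♯ ↔ (S2FinLetter ∧ S2QpsiLetter)` and the organ-level equivalence
  `organsXiInf_iff_organsKompakt : (S2FinLetter ∧ S2QpsiLetter) ↔ (S2FinLetter ∧ S2CasimirIotaLetter ∧ S2CasimirTauLetter)` (⟹ §3; ⟸ through S2♯ by ★ (C4) + §2 —
  the honest route: CASIMIR-ι∕τ give `qψ = ±1` only via the CENTRAL identity inside ★ (K1)∕(B6), packaged here through the certificate).
Nothing printed is discharged: FIN stays [Rogawski1990 Thm. 13.3.6 (c), Thm. 14.6.4]; «Ξ∞ ∕ QPSI» is [Marshall2014 §3.3–3.4, §4.1] = [Rogawski1990 Thm. 13.3.6 (c), §13.3,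
§12.3 p. 178, §14.6 pp. 242–243, Thm. 14.6.4] read at every archimedean place — packet rigidity, crux-sized, no prover organ.
HONEST LABEL: HC_CM is proved only modulo the 7 printed citations (2 remaining: hLiu418 = stmt-HodgeConjecture-24832, h413 = stmt-HodgeConjecture-24833) until
rung 0 closes; count-neutral (no books digit moves; #80 stays one UNPROVED row).

References: [Marshall2014] S. Marshall, *Endoscopy and cohomology growth on U(3)*, Compositio Math. 150 (2014) 903–910, §3.3 «Real places», §3.4, §4.1 (`Ξ_∞`);
[Rogawski1990] J. Rogawski, *Automorphic representations of unitary groups in three variables*, Ann. of Math. Stud. 123 (1990): §12.3 pp. 174–178 (p. 178), §13.1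
p. 199, §13.3, Thm. 13.3.5 and Thm. 13.3.6 (c) (p. 202), §14.6 pp. 242–243 and Thm. 14.6.4 (p. 243), Prop. 15.2.1 (b) and §15.3 ¶1 (p. 249); [Liu2021] Y. Liu, Camb. J.
Math. 9 (2021), Remark 4.2.
-/

-- Mathlib idiom (as in ★ (C4), ★ `CohDiscreteMemXiFamilyArchPinned`): commutator bracket on `Module.End ℂ M`, load-bearing for the token binder of FIN ∕ CASIMIR-ι.
attribute [local instance 100] LieRing.ofAssociativeRing

set_option autoImplicit false
-- the mandated namespace has the single-problem summit's repeated segment (`HodgeConjecture.HodgeConjecture`)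
set_option linter.dupNamespace false

noncomputable section

open NumberField IsDedekindDomain MeasureTheory
open scoped Matrix ComplexOrder

namespace Summit.HodgeConjecture.HodgeConjecture.Cruxes.H413.F0P3cS2SharpOrgansOfS2SharpXiInf

open Literature.NumberTheory.Automorphic Literature.NumberTheory.Automorphic.UnitaryGroup
open Literature.NumberTheory.Automorphic.UnitaryGroup.CotangentForms
open Literature.NumberTheory.Automorphic.Arthur2013.Leaves.TECR
open Literature.NumberTheory.GaloisRepresentations
open Literature.NumberTheory.Rogawski1990
open Literature.RepresentationTheory.BorelWallach2000
open Literature.RepresentationTheory.KonnoKonno2007 Literature.RepresentationTheory.KonnoKonno2007.RealDualPair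
open Literature.RepresentationTheory.KonnoKonno2007.RealDualPair.UForm
open Summit.HodgeConjecture.HodgeConjecture.Cruxes.H413.F0P3XiArchDataOfRecord
open Summit.HodgeConjecture.HodgeConjecture.Cruxes.H413.F0P3CompactTrivOfRecord (cmCompactFactor_rightRegular_eq_self_of_isHolOrAntihol)
open Summit.HodgeConjecture.HodgeConjecture.Cruxes.H413.F0P3cPinCompactChi (S2PinCompactLetter S2CasimirTauLetter)
open Summit.HodgeConjecture.HodgeConjecture.Cruxes.H413.F0P3cS2SharpOrgansOfS2SharpKompakt
  (S2FinLetter S2CasimirIotaLetter s2sharp_of_organsKompakt s2Fin_of_S2sharp' organsKompakt_of_s2sharp)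
open Summit.HodgeConjecture.HodgeConjecture.Cruxes.H413.F0P3cS2SharpQpsi (qpsi_of_S2sharp sq_sum_eq_two_of_qpsi casimirTau_of_qpsi pinCompact_of_qpsi)

/-! ## §1 The letter «Ξ∞ ∕ QPSI ± 1» on the CENTRAL-ι frame (chair's text, LH1-plan (g4) 08:12:58Z) -/

/-- **LETTER «Ξ∞ ∕ QPSI ± 1» — the printed archimedean residue of #80 S2♯ as ONE token-free, `K_c`-free sentence**: at the compact CM frame
(`L ι H T hT`, `hdef`, `h2`, `μ`, `μω hμu`, `μω|_{𝕀_{L⁺}} = ω_{L∕L⁺}`), for every discrete `P` of (anti)holomorphic cotangent type at the frame and EVERY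
one-dimensional automorphic `ξ` of `H` with `MemXiFamily P … μω hμu ξ`, the `det`-exponent of `ξ` is `±1` at EVERY complex embedding: `∀ τ, ξ.qψ τ = 1 ∨ ξ.qψ τ = −1`
(«every `ξ` whose family carries a cotangent discrete `P` lies in Marshall's `Ξ_∞`»).  Binders = ★ (B0) `S2CentralIotaLetter`'s through `MemXiFamily P … ξ →`.
PRINT: [Marshall2014, §3.3 «Real places» (the two characters `(det₀)^{−t−1}λ¹`, `(det₀)^{−t}λ^{−1}` at the real place and at the compact places), §3.4 (`π ∈ Π(ξ)`,
citing Rogawski Thm. 13.3.6), §4.1 (`Ξ_∞`)]; [Rogawski1990, Thm. 13.3.5 and Thm. 13.3.6 (c) (p. 202), §13.3, §13.1 p. 199, §12.3 p. 178, §14.6 pp. 242–243 and Thm. 14.6.4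
(p. 243), §15.3 ¶1 (p. 249)].  RESIDUE HONESTY: the centre pays `a+b+c = 0` in-house («ZENTRUM» ★); print pays only the sign datum `qψ = ±1`. -/
def S2QpsiLetter : Prop :=
  ∀ (L : Type) [Field L] [NumberField L] [IsCMField L] (ι : L →+* ℂ) (H : Matrix (Fin 3) (Fin 3) L) (T : GL (Fin 3) ℂ)
    (hT : (T : Matrix (Fin 3) (Fin 3) ℂ)ᴴ * H.map ι * (T : Matrix (Fin 3) (Fin 3) ℂ) = Literature.Geometry.ComplexHyperbolic.BallModel.J),
    (∀ τ' : L →+* ℂ, InfinitePlace.mk τ' ≠ InfinitePlace.mk ι → (H.map τ').PosDef) →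
    2 ≤ Module.finrank ℚ ↥(maximalRealSubfield L) →
    ∀ (μ : Measure (adelicGroupData (↥(maximalRealSubfield L)) L (IsCMField.complexConj L) 3 H).automorphicQuotient)
      [(adelicGroupData (↥(maximalRealSubfield L)) L (IsCMField.complexConj L) 3 H).IsAutomorphicMeasure μ]
      (μω : HeckeCharacter L) (hμu : μω.IsUnitary),
      (∀ x : Literature.NumberTheory.GaloisRepresentations.ideleGroup ↥(maximalRealSubfield L),
        μω (AdeleRing.ideleBaseChange (↥(maximalRealSubfield L)) L x) = quadraticHeckeCharCM L x) →
    ∀ (P : DiscreteAutomorphicRep (adelicGroupData (↥(maximalRealSubfield L)) L (IsCMField.complexConj L) 3 H) μ),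
      (P.IsHolCotangentAt (cmArchSection L ι H T hT) (cmCompactFactor L ι H T hT) ∨
        P.IsAntiholCotangentAt (cmArchSection L ι H T hT) (cmCompactFactor L ι H T hT)) →
        ∀ ξ : OneDimAutRepH L,
          MemXiFamily P (transpose_map_cmConjRingHom_eq_of_frame L ι H T hT) (isUnit_det_of_frame L ι H T hT) μω hμu ξ →
            ∀ τ : L →+* ℂ, ξ.qψ τ = 1 ∨ ξ.qψ τ = -1

/-! ## §2 S2♯ ⟹ «Ξ∞» (★ (Q1) `qpsi_of_S2sharp` on the PIN-τ frame, its `K_c` clause discharged by ★ p819716) -/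

/-- **The letter implies ★ (Q1)'s telescope** (drop the `K_c` binder): «Ξ∞» on the CENTRAL-ι frame is the STRONGER statement.
[cite: Marshall2014, §3.3; §4.1] [cite: Rogawski1990, §12.3 p. 178; §14.6 pp. 242–243] -/
theorem qpsiTelescope_of_qpsi (hQ : S2QpsiLetter) :
    ∀ (L : Type) [Field L] [NumberField L] [IsCMField L] (ι : L →+* ℂ) (H : Matrix (Fin 3) (Fin 3) L) (T : GL (Fin 3) ℂ)
      (hT : (T : Matrix (Fin 3) (Fin 3) ℂ)ᴴ * H.map ι * (T : Matrix (Fin 3) (Fin 3) ℂ) = Literature.Geometry.ComplexHyperbolic.BallModel.J),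
      (∀ τ' : L →+* ℂ, InfinitePlace.mk τ' ≠ InfinitePlace.mk ι → (H.map τ').PosDef) →
      2 ≤ Module.finrank ℚ ↥(maximalRealSubfield L) →
      ∀ (μ : Measure (adelicGroupData (↥(maximalRealSubfield L)) L (IsCMField.complexConj L) 3 H).automorphicQuotient)
        [(adelicGroupData (↥(maximalRealSubfield L)) L (IsCMField.complexConj L) 3 H).IsAutomorphicMeasure μ]
        (μω : HeckeCharacter L) (hμu : μω.IsUnitary),
        (∀ x : Literature.NumberTheory.GaloisRepresentations.ideleGroup ↥(maximalRealSubfield L),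
          μω (AdeleRing.ideleBaseChange (↥(maximalRealSubfield L)) L x) = quadraticHeckeCharCM L x) →
      ∀ (P : DiscreteAutomorphicRep (adelicGroupData (↥(maximalRealSubfield L)) L (IsCMField.complexConj L) 3 H) μ),
        (P.IsHolCotangentAt (cmArchSection L ι H T hT) (cmCompactFactor L ι H T hT) ∨
          P.IsAntiholCotangentAt (cmArchSection L ι H T hT) (cmCompactFactor L ι H T hT)) →
        (∀ k : (adelicGroupData (↥(maximalRealSubfield L)) L (IsCMField.complexConj L) 3 H).Adelic, k ∈ cmCompactFactor L ι H T hT →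
          ∀ v : P.space.toSubmodule, (adelicGroupData (↥(maximalRealSubfield L)) L (IsCMField.complexConj L) 3 H).rightRegular μ k
            (v : (adelicGroupData (↥(maximalRealSubfield L)) L (IsCMField.complexConj L) 3 H).L2 μ) = v) →
        ∀ ξ : OneDimAutRepH L,
          MemXiFamily P (transpose_map_cmConjRingHom_eq_of_frame L ι H T hT) (isUnit_det_of_frame L ι H T hT) μω hμu ξ →
            ∀ τ : L →+* ℂ, ξ.qψ τ = 1 ∨ ξ.qψ τ = -1 :=
  fun L _ _ _ ι H T hT hdef h2 μ _ μω hμu hμω P hP _ ξ hmem τ => hQ L ι H T hT hdef h2 μ μω hμu hμω P hP ξ hmem τ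

/-- **S2♯ ⟹ «Ξ∞»** on the CENTRAL-ι frame: ★ (Q1) `qpsi_of_S2sharp` needs the `K_c`-triviality of `P`, which HOLDS for a cotangent `P` (★ p819716
`cmCompactFactor_rightRegular_eq_self_of_isHolOrAntihol`) — so the `K_c`-free letter is implied by the closer stub all the same (a RE-CUT of #80, never a strengthening).
[cite: Marshall2014, §3.3; §3.4; §4.1] [cite: Rogawski1990, Thm. 13.3.6 (c) (p. 202); §12.3 p. 178; §14.6 Thm. 14.6.4 (p. 243); §15.3 ¶1 (p. 249)] -/
theorem qpsi_of_S2sharp' (h : cohDiscrete_memXiFamily_archPinned) : S2QpsiLetter :=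
  fun L _ _ _ ι H T hT hdef h2 μ _ μω hμu hμω P hP ξ hmem τ =>
    qpsi_of_S2sharp h L ι H T hT hdef h2 μ μω hμu hμω P hP (cmCompactFactor_rightRegular_eq_self_of_isHolOrAntihol L ι H T hT P hP) ξ hmem τ

/-! ## §3 «Ξ∞» ⟹ the ED. 4 organs CASIMIR-ι, CASIMIR-τ (and PIN-τ) — ★ (Q1) read-backs by name -/

/-- **«Ξ∞» ⟹ LETTER CASIMIR-ι** (★ (C4)'s `S2CasimirIotaLetter` = the leaf's organ text): ★ (Q1) `sq_sum_eq_two_of_qpsi` at `τ = ι`; the letter's token binders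
`(M, σK, σ𝔤, hM, irreducible, T₁ ≠ 0)` are not used. [cite: Marshall2014, §3.3; §4.1] [cite: Rogawski1990, §12.3 p. 178] [cite: BorelWallach2000, II Prop. 6.12 (2)] -/
theorem casimirIota_of_qpsi (hQ : S2QpsiLetter) : S2CasimirIotaLetter :=
  fun L _ _ _ ι H T hT hdef h2 μ _ μω hμu hμω P hP _ _ _ _ _ _ _ _ ξ hmem a b c habc =>
    sq_sum_eq_two_of_qpsi (qpsiTelescope_of_qpsi hQ) L ι H T hT hdef h2 μ μω hμu hμω P hP ξ hmem ι a b c habc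

/-- **«Ξ∞» ⟹ LETTER CASIMIR-τ** (★ (K1) `S2CasimirTauLetter`; ★ (Q1) `casimirTau_of_qpsi` by name). [cite: Marshall2014, §3.3; §4.1] [cite: Rogawski1990, §14.6 pp. 242–243; §12.3 pp. 176, 178] -/
theorem casimirTau_of_qpsi' (hQ : S2QpsiLetter) : S2CasimirTauLetter :=
  casimirTau_of_qpsi (qpsiTelescope_of_qpsi hQ)

/-- **«Ξ∞» ⟹ LETTER PIN-τ** (★ (K1) `S2PinCompactLetter`; ★ (Q1) `pinCompact_of_qpsi` by name). [cite: Marshall2014, §3.3; §4.1] [cite: Rogawski1990, §14.6 pp. 242–243; §12.3 pp. 176, 178] -/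
theorem pinCompact_of_qpsi' (hQ : S2QpsiLetter) : S2PinCompactLetter :=
  pinCompact_of_qpsi (qpsiTelescope_of_qpsi hQ)

/-- **«Ξ∞» ⟹ CASIMIR-ι ∧ CASIMIR-τ** (§3 bundled: ED. 5's single organ pays both ED. 4 organs). [cite: Marshall2014, §3.3; §4.1] [cite: Rogawski1990, §12.3 p. 178; §14.6 pp. 242–243] -/
theorem casimir_of_qpsi (hQ : S2QpsiLetter) : S2CasimirIotaLetter ∧ S2CasimirTauLetter :=
  ⟨casimirIota_of_qpsi hQ, casimirTau_of_qpsi' hQ⟩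

/-! ## §4 FIN ∧ «Ξ∞» ⟹ S2♯ — through the ★ (C4) head (ED. 5 factors through ED. 4's organ set) -/

/-- **FIN ∧ «Ξ∞» ⟹ S2♯**: ★ (C4) `s2sharp_of_organsKompakt` fed with FIN and the two Casimir organs of §3 — LEAF ED. 5's head composition, Theorems-side.
[cite: Marshall2014, §3.3; §3.4; §4.1] [cite: Rogawski1990, §14.6 Thm. 14.6.4 (p. 243); Thm. 13.3.6 (c) (p. 202); §12.3 pp. 174–178; Prop. 15.2.1 (b) (p. 249)] [cite: Liu2021, Remark 4.2] -/
theorem s2sharp_of_fin_qpsi (hFin : S2FinLetter) (hQ : S2QpsiLetter) : cohDiscrete_memXiFamily_archPinned :=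
  s2sharp_of_organsKompakt hFin (casimirIota_of_qpsi hQ) (casimirTau_of_qpsi' hQ)

/-! ## §5 THE CERTIFICATE -/

/-- **THE EQUIVALENCE CERTIFICATE FOR LEAF ED. 5 «Ξ∞»** — the print letter #80 S2♯ ★ `cohDiscrete_memXiFamily_archPinned` is EQUIVALENT to FIN ∧ «Ξ∞ ∕ QPSI ± 1»
(texts token for token), modulo the in-house ★ facts (`K_c`-triviality and the cohomological token of a cotangent `P`, U♭ on the cotangent locus, the unitary
archimedean type of record of `μω`, the «ZENTRUM» CENTRAL identity at every place): the desk's rule (f) «organs = #80's content modulo ★» for ED. 5, as a kernel object;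
sorries 3 → 2 is a RE-CUT, not a strengthening.  Nothing printed is discharged.
[cite: Marshall2014, §3.3; §3.4; §4.1] [cite: Rogawski1990, §14.6 Thm. 14.6.4 (p. 243) and pp. 242–243; Thm. 13.3.5 and Thm. 13.3.6 (c) (p. 202); §12.3 pp. 174–178; Prop. 15.2.1 (b) (p. 249); §13.1 p. 199]
[cite: Liu2021, Remark 4.2] -/
theorem s2sharp_iff_organsXiInf : cohDiscrete_memXiFamily_archPinned ↔ (S2FinLetter ∧ S2QpsiLetter) :=
  ⟨fun h => ⟨s2Fin_of_S2sharp' h, qpsi_of_S2sharp' h⟩, fun h => s2sharp_of_fin_qpsi h.1 h.2⟩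

/-- **ED. 5 ≡ ED. 4 at the organ level, by theorem**: FIN ∧ «Ξ∞» ⟺ FIN ∧ CASIMIR-ι ∧ CASIMIR-τ (⟹ §3; ⟸ through S2♯: ★ (C4) `s2sharp_of_organsKompakt` then §2 —
CASIMIR-ι∕τ yield `qψ = ±1` only together with the ★ CENTRAL identity, which the certificate route packages). [cite: Marshall2014, §3.3; §4.1] [cite: Rogawski1990, §12.3 p. 178; §14.6 pp. 242–243] -/
theorem organsXiInf_iff_organsKompakt :
    (S2FinLetter ∧ S2QpsiLetter) ↔ (S2FinLetter ∧ S2CasimirIotaLetter ∧ S2CasimirTauLetter) :=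
  ⟨fun h => ⟨h.1, casimirIota_of_qpsi h.2, casimirTau_of_qpsi' h.2⟩,
    fun h => ⟨h.1, qpsi_of_S2sharp' (s2sharp_of_organsKompakt h.1 h.2.1 h.2.2)⟩⟩

end Summit.HodgeConjecture.HodgeConjecture.Cruxes.H413.F0P3cS2SharpOrgansOfS2SharpXiInf

end
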